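import Literature.NumberTheory.NumberFields.IdelicArtinMapKernel
import HarnessLib

/-!
# A continuous homomorphism of idèle groups carrying principal idèles to principal idèles descends to the
# abelianized Galois groups: `η ∘ [·, k] = [·, K] ∘ f` (Milne, *Complex Multiplication*, Ch. II §9, Lemma 9.8)

Topic `NumberTheory/NumberFields` (global class field theory, idelic dictionary); namespace
`Literature.NumberTheory.NumberFields`.  Lane `lit-hodgefound` (Track 2, Layer A3 skeleton seat `skel-3`, row
A3-G39 FILE 1: the number-theoretic preliminaries of the fundamental theorem of complex multiplication over the
reflex field, Milne CM Ch. II §9 Lemmas 9.5–9.9).  One definition with a body (`inducedArtinHom`, the homomorphism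
`η` of the lemma) and theorems, all proved; no named fact, no instance (D-0026, net debt 0).  Sequel of flt-inv's
`…IdelicArtinMap` (Shimura's `[a, K] = ideleArtinMap K a`, onto `Γ_K^ab`) and `…IdelicArtinMapKernel`
(`ker [·, K] = closure(K^× · (𝕀_K)⁰)`, Shimura §18.3 / Tate §5.6 as an equality).

## The print, verbatim

J. S. Milne, *Complex Multiplication* (course notes, version of July 14, 2020) [MilneCM2006], Ch. II §9 «More
preliminaries from algebraic number theory», p. 77:

> «LEMMA 9.8 Let `E` be a CM-field and `Φ` a CM-type on `E`. There exists a unique homomorphism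
> `Gal(E*^ab/E*) → Gal(E^ab/E)` rendering [`𝔸^×_{f,E*} →^{N_Φ} 𝔸^×_{f,E}`; `art_{E*} ↓`, `↓ art_E`;
> `Gal(E*^ab/E*) → Gal(E^ab/E)`] commutative.  PROOF. As `art_E : 𝔸^×_{f,E} → Gal(E^ab/E)` is surjective, the
> uniqueness is obvious. On the other hand, `N_Φ` maps `E*^×` into `E^×` and is continuous, and so it maps the
> closure of `E*^×` into the closure of `E^×`.»

(p. 76: «We write art for the reciprocal reciprocity map, i.e., `art_k(s) = rec_k(s)⁻¹` for `s ∈ 𝔸^×_k`. When `k`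
is totally imaginary, it factors through `𝔸^×_{f,k}` […] then `art_k : 𝔸^×_{f,k} → Gal(k^ab/k)` is surjective
with kernel the closure of `k^×` (embedded diagonally) in `𝔸^×_{f,k}`.»)

## What is formalised: the lemma in the generality its proof uses

The printed proof uses of `N_Φ` exactly two things — it is CONTINUOUS and it maps principal idèles to principal
idèles — and of the Artin maps that they are onto with kernel a closure.  This file therefore proves, for ANY
two number fields `k K : Type` and ANY continuous homomorphism `f : 𝕀_k →* 𝕀_K` with `f(k^×) ⊆ K^×`:

* §1 `f` carries the identity component `(𝕀_k)⁰` into `(𝕀_K)⁰` (`map_connectedComponentOfOne_le`) and the closure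
  of `k^× · (𝕀_k)⁰` into the closure of `K^× · (𝕀_K)⁰` (`map_topologicalClosure_principalIdeles_sup_le`); hence, by
  flt-inv's `ker_ideleArtinMap_eq_topologicalClosure` (for `k`) and `closure_le_ker_ideleArtinMap` (for `K`),
  **`ker [·, k] ≤ ker ([·, K] ∘ f)`** (`ker_ideleArtinMap_le_ker_ideleArtinMap_comp`) — the printed «it maps the
  closure of `E*^×` into the closure of `E^×`», for all number fields at once (for a totally imaginary field the
  identity component is the archimedean part and the closure is that of the principal idèles times `k_∞^×`,
  `…IdelicArtinMapKernel`'s `ker_ideleArtinMap_eq_topologicalClosure_of_isTotallyComplex`).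
* §2 **THE HOMOMORPHISM `η`** (`inducedArtinHom f hf hfp : Γ_k^ab →* Γ_K^ab`, a definition with a body:
  `MonoidHom.liftOfRightInverse` along the surjection `[·, k]`), **`inducedArtinHom_ideleArtinMap`:
  `η [s, k] = [f s, K]`**, uniqueness `eq_inducedArtinHom_of_comp_eq` («the uniqueness is obvious»), and the
  printed existence-and-uniqueness sentence **`existsUnique_monoidHom_comp_ideleArtinMap`**.
* §3 the finite-level reading `η [s, k]|_{L'} = ψ_{L'|K}(f s)` for every finite abelian `L' ⊆ K̄`
  (`abRestrict_inducedArtinHom_ideleArtinMap`), `η [s, k] = 1 ↔ [f s, K] = 1`, and functoriality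
  (`inducedArtinHom_id`, `inducedArtinHom_comp`: uniqueness makes `f ↦ η_f` compatible with composition).

Milne's lemma itself is the instance `f = N_Φ` (flt-inv's `reflexNormIdele K Φ k`, continuous, principal idèles to
principal idèles by `reflexNormIdele_mem_principalIdeles`), drawn in the row's FILE 3
(`…ComplexMultiplication/ReflexNormArtinMap`); Tate's norm compatibility (Cassels–Fröhlich VII Prop. 4.3, flt-inv's
`…IdelicArtinMapNormCompatibility`) is the instance `f = N_{K'/K}` with `η` = restriction, by uniqueness.

CONVENTIONS.  The tree's `[·, K] = ideleArtinMap K` is the reciprocity map `rec` (a prime element at an unramified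
prime goes to the arithmetic Frobenius); Milne's `art_K = rec_K⁻¹` differs by inversion on the (abelian) target, which
changes neither kernels nor the induced `η`.  Milne draws the square on the FINITE idèles of totally imaginary
fields; here it is drawn on the full idèle groups of arbitrary number fields (for `K` totally complex `[a, K]`
depends only on `a_𝐡`, `…IdelicArtinMap`'s `ideleArtinMap_eq_of_snd_eq`).

NOT HERE: continuity of `η` (not asserted by the print); the instance `f = N_Φ` and Lemmas 9.5–9.7, 9.9 (FILES 2–3
of the row).

## References

* J. S. Milne, *Complex Multiplication* (course notes, 2006; version July 14, 2020), Ch. II §9, Lemma 9.8 and the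
  paragraph «More preliminaries from algebraic number theory» (pp. 76–77). [MilneCM2006]
* G. Shimura, *Abelian Varieties with Complex Multiplication and Modular Functions*, Princeton 1998, §18.3
  (p. 122: `[a, M]`, its kernel). [Shimura1998]
* J. Tate, *Global class field theory*, Ch. VII of Cassels–Fröhlich, *Algebraic Number Theory* (1967), §5.6,
  Prop. 4.3. [CasselsFrohlichANT1967]

## Provenance

Lane `lit-hodgefound`, seat `literature-prover-lit-hodgefound-skel-3-g25-0` (row A3-G39, FILE 1 of 3).
-/

noncomputable section

open NumberField Field

namespace Literature.NumberTheory.NumberFields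

open Literature.NumberTheory.GaloisRepresentations

variable {k K : Type} [Field k] [NumberField k] [Field K] [NumberField K]

/-! ### §1. A continuous `f : 𝕀_k → 𝕀_K` with `f(k^×) ⊆ K^×` maps `ker [·, k]` into `ker [·, K]` -/

section Kernel

variable (f : ideleGroup k →* ideleGroup K)

/-- A continuous homomorphism of idèle groups maps the identity component `(𝕀_k)⁰` into `(𝕀_K)⁰` (the continuous
image of a connected set containing `1` is connected and contains `1`).
[cite: MilneCM2006, Ch. II §9, Lemma 9.8 proof (p. 77)] -/
theorem map_connectedComponentOfOne_le (hf : Continuous f) :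
    (Subgroup.connectedComponentOfOne (ideleGroup k)).map f ≤
      Subgroup.connectedComponentOfOne (ideleGroup K) := by
  rintro y ⟨x, hx, rfl⟩
  have h := hf.image_connectedComponent_subset (1 : ideleGroup k) ⟨x, hx, rfl⟩
  rwa [map_one] at h

/-- `f` maps `k^× · (𝕀_k)⁰` into `K^× · (𝕀_K)⁰` when it maps principal idèles to principal idèles.
[cite: MilneCM2006, Ch. II §9, Lemma 9.8 proof (p. 77)] -/
theorem map_principalIdeles_sup_connectedComponentOfOne_le (hf : Continuous f)
    (hfp : ∀ a ∈ principalIdeles k, f a ∈ principalIdeles K) :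
    (principalIdeles k ⊔ Subgroup.connectedComponentOfOne (ideleGroup k)).map f ≤
      principalIdeles K ⊔ Subgroup.connectedComponentOfOne (ideleGroup K) := by
  rw [Subgroup.map_sup]
  refine sup_le_sup ?_ (map_connectedComponentOfOne_le f hf)
  rintro y ⟨x, hx, rfl⟩
  exact hfp x hx

/-- **«it maps the closure of `E*^×` into the closure of `E^×`»**: a continuous `f` with `f(k^×) ⊆ K^×` maps
`closure(k^× · (𝕀_k)⁰)` into `closure(K^× · (𝕀_K)⁰)`. [cite: MilneCM2006, Ch. II §9, Lemma 9.8 proof (p. 77)] -/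
theorem map_topologicalClosure_principalIdeles_sup_le (hf : Continuous f)
    (hfp : ∀ a ∈ principalIdeles k, f a ∈ principalIdeles K) :
    ((principalIdeles k ⊔ Subgroup.connectedComponentOfOne (ideleGroup k)).topologicalClosure).map f ≤
      (principalIdeles K ⊔ Subgroup.connectedComponentOfOne (ideleGroup K)).topologicalClosure := by
  rintro y ⟨x, hx, rfl⟩
  change f x ∈ closure ((principalIdeles K ⊔ Subgroup.connectedComponentOfOne (ideleGroup K) :
    Subgroup (ideleGroup K)) : Set (ideleGroup K))
  refine map_mem_closure hf hx ?_
  intro a ha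
  exact map_principalIdeles_sup_connectedComponentOfOne_le f hf hfp ⟨a, ha, rfl⟩

/-- **`ker [·, k] ≤ ker ([·, K] ∘ f)`** for a continuous homomorphism `f : 𝕀_k → 𝕀_K` of idèle groups with
`f(k^×) ⊆ K^×`: the kernel of `[·, k]` is `closure(k^× · (𝕀_k)⁰)` (Shimura §18.3 / Tate §5.6, the tree's
`ker_ideleArtinMap_eq_topologicalClosure`), which `f` carries into `closure(K^× · (𝕀_K)⁰) ⊆ ker [·, K]`.
[cite: MilneCM2006, Ch. II §9, Lemma 9.8 proof (p. 77)] [cite: Shimura1998, §18.3, p. 122] -/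
theorem ker_ideleArtinMap_le_ker_ideleArtinMap_comp (hf : Continuous f)
    (hfp : ∀ a ∈ principalIdeles k, f a ∈ principalIdeles K) :
    (ideleArtinMap k).ker ≤ ((ideleArtinMap K).comp f).ker := by
  intro x hx
  rw [MonoidHom.mem_ker, MonoidHom.comp_apply, ← MonoidHom.mem_ker]
  rw [ker_ideleArtinMap_eq_topologicalClosure] at hx
  exact closure_le_ker_ideleArtinMap (map_topologicalClosure_principalIdeles_sup_le f hf hfp ⟨x, hx, rfl⟩)

/-- Pointwise form: `[s, k] = 1 → [f s, K] = 1`. [cite: MilneCM2006, Ch. II §9, Lemma 9.8 proof (p. 77)] -/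
theorem ideleArtinMap_map_eq_one_of_ideleArtinMap_eq_one (hf : Continuous f)
    (hfp : ∀ a ∈ principalIdeles k, f a ∈ principalIdeles K) {s : ideleGroup k}
    (hs : ideleArtinMap k s = 1) : ideleArtinMap K (f s) = 1 := by
  have h := ker_ideleArtinMap_le_ker_ideleArtinMap_comp f hf hfp ((MonoidHom.mem_ker).2 hs)
  rwa [MonoidHom.mem_ker, MonoidHom.comp_apply] at h

/-- Consequently `[s, k] = [s', k] → [f s, K] = [f s', K]`. [cite: MilneCM2006, Ch. II §9, Lemma 9.8 (p. 77)] -/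
theorem ideleArtinMap_map_eq_of_ideleArtinMap_eq (hf : Continuous f)
    (hfp : ∀ a ∈ principalIdeles k, f a ∈ principalIdeles K) {s s' : ideleGroup k}
    (hs : ideleArtinMap k s = ideleArtinMap k s') : ideleArtinMap K (f s) = ideleArtinMap K (f s') := by
  rw [← inv_mul_eq_one, ← map_inv, ← map_mul] at hs ⊢
  rw [← map_inv, ← map_mul]
  exact ideleArtinMap_map_eq_one_of_ideleArtinMap_eq_one f hf hfp hs

end Kernel

/-! ### §2. The induced homomorphism `η : Γ_k^ab → Γ_K^ab` (Lemma 9.8) -/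

section Induced

variable (f : ideleGroup k →* ideleGroup K) (hf : Continuous f)
  (hfp : ∀ a ∈ principalIdeles k, f a ∈ principalIdeles K)

/-- **The homomorphism `η : Gal(k^ab/k) → Gal(K^ab/K)` induced by a continuous homomorphism of idèle groups
`f : 𝕀_k → 𝕀_K` with `f(k^×) ⊆ K^×`** — Milne's Lemma 9.8 (there `f = N_Φ`): the lift of `[·, K] ∘ f` along the
surjection `[·, k] : 𝕀_k ↠ Γ_k^ab`, which exists because `ker [·, k] ≤ ker ([·, K] ∘ f)`.
[cite: MilneCM2006, Ch. II §9, Lemma 9.8 (p. 77)] -/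
def inducedArtinHom : absoluteGaloisGroupAbelianization k →* absoluteGaloisGroupAbelianization K :=
  (ideleArtinMap k).liftOfRightInverse (Function.surjInv (ideleArtinMap_surjective k))
    (Function.rightInverse_surjInv (ideleArtinMap_surjective k))
    ⟨(ideleArtinMap K).comp f, ker_ideleArtinMap_le_ker_ideleArtinMap_comp f hf hfp⟩

/-- **The square commutes: `η [s, k] = [f s, K]`.** [cite: MilneCM2006, Ch. II §9, Lemma 9.8 (p. 77)] -/
@[simp] theorem inducedArtinHom_ideleArtinMap (s : ideleGroup k) :
    inducedArtinHom f hf hfp (ideleArtinMap k s) = ideleArtinMap K (f s) :=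
  (ideleArtinMap k).liftOfRightInverse_comp_apply _ _ _ s

/-- `η ∘ [·, k] = [·, K] ∘ f`. [cite: MilneCM2006, Ch. II §9, Lemma 9.8 (p. 77)] -/
theorem inducedArtinHom_comp_ideleArtinMap :
    (inducedArtinHom f hf hfp).comp (ideleArtinMap k) = (ideleArtinMap K).comp f :=
  MonoidHom.ext (inducedArtinHom_ideleArtinMap f hf hfp)

/-- **Uniqueness** («As `art` […] is surjective, the uniqueness is obvious»): any `η'` with
`η' ∘ [·, k] = [·, K] ∘ f` is `η`. [cite: MilneCM2006, Ch. II §9, Lemma 9.8 (p. 77)] -/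
theorem eq_inducedArtinHom_of_comp_eq
    {η : absoluteGaloisGroupAbelianization k →* absoluteGaloisGroupAbelianization K}
    (hη : η.comp (ideleArtinMap k) = (ideleArtinMap K).comp f) : η = inducedArtinHom f hf hfp :=
  (ideleArtinMap k).eq_liftOfRightInverse _ _ _ _ η hη

/-- Uniqueness, pointwise hypothesis. [cite: MilneCM2006, Ch. II §9, Lemma 9.8 (p. 77)] -/
theorem eq_inducedArtinHom_of_forall
    {η : absoluteGaloisGroupAbelianization k →* absoluteGaloisGroupAbelianization K}
    (hη : ∀ s : ideleGroup k, η (ideleArtinMap k s) = ideleArtinMap K (f s)) : η = inducedArtinHom f hf hfp :=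
  eq_inducedArtinHom_of_comp_eq f hf hfp (MonoidHom.ext hη)

/-- Two homomorphisms `Γ_k^ab → Γ_K^ab` agreeing after `[·, k]` are equal (surjectivity of `[·, k]`).
[cite: MilneCM2006, Ch. II §9, Lemma 9.8 proof (p. 77)] -/
theorem monoidHom_eq_of_comp_ideleArtinMap_eq {G : Type*} [Monoid G]
    {η η' : absoluteGaloisGroupAbelianization k →* G}
    (h : η.comp (ideleArtinMap k) = η'.comp (ideleArtinMap k)) : η = η' :=
  (MonoidHom.cancel_right (ideleArtinMap_surjective k)).1 h

/-- **LEMMA 9.8 (existence and uniqueness).**  For a continuous homomorphism `f : 𝕀_k → 𝕀_K` of idèle groups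
with `f(k^×) ⊆ K^×` there exists a unique homomorphism `η : Gal(k^ab/k) → Gal(K^ab/K)` rendering the square
`η ∘ [·, k] = [·, K] ∘ f` commutative. [cite: MilneCM2006, Ch. II §9, Lemma 9.8 (p. 77)] -/
theorem existsUnique_monoidHom_comp_ideleArtinMap (hf : Continuous f)
    (hfp : ∀ a ∈ principalIdeles k, f a ∈ principalIdeles K) :
    ∃! η : absoluteGaloisGroupAbelianization k →* absoluteGaloisGroupAbelianization K,
      η.comp (ideleArtinMap k) = (ideleArtinMap K).comp f :=
  ⟨inducedArtinHom f hf hfp, inducedArtinHom_comp_ideleArtinMap f hf hfp,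
    fun _ hη => eq_inducedArtinHom_of_comp_eq f hf hfp hη⟩

/-- `η g = [f s, K]` for ANY idèle `s` with `[s, k] = g` (the value does not depend on the choice of `s`).
[cite: MilneCM2006, Ch. II §9, Lemma 9.8 (p. 77)] -/
theorem inducedArtinHom_eq_of_ideleArtinMap_eq {g : absoluteGaloisGroupAbelianization k} {s : ideleGroup k}
    (hs : ideleArtinMap k s = g) : inducedArtinHom f hf hfp g = ideleArtinMap K (f s) := by
  rw [← hs, inducedArtinHom_ideleArtinMap]

/-- `η [s, k] = 1 ↔ [f s, K] = 1`. [cite: MilneCM2006, Ch. II §9, Lemma 9.8 (p. 77)] -/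
theorem inducedArtinHom_ideleArtinMap_eq_one_iff (s : ideleGroup k) :
    inducedArtinHom f hf hfp (ideleArtinMap k s) = 1 ↔ ideleArtinMap K (f s) = 1 := by
  rw [inducedArtinHom_ideleArtinMap]

/-- `η` is onto when `[·, K] ∘ f` is (e.g. `f` surjective). [cite: MilneCM2006, Ch. II §9, Lemma 9.8 (p. 77)] -/
theorem inducedArtinHom_surjective_of_surjective (h : Function.Surjective ((ideleArtinMap K).comp f)) :
    Function.Surjective (inducedArtinHom f hf hfp) := by
  intro g
  obtain ⟨s, hs⟩ := h g
  exact ⟨ideleArtinMap k s, by rw [inducedArtinHom_ideleArtinMap, ← hs, MonoidHom.comp_apply]⟩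

end Induced

/-! ### §3. Finite level, functoriality -/

section FiniteLevel

variable (f : ideleGroup k →* ideleGroup K) (hf : Continuous f)
  (hfp : ∀ a ∈ principalIdeles k, f a ∈ principalIdeles K)
variable (L' : IntermediateField K (AlgebraicClosure K)) [FiniteDimensional K L'] [IsAbelianGalois K L']

/-- **Finite level**: on a finite abelian `L' ⊆ K̄`, `η [s, k]|_{L'} = ψ_{L'|K}(f s)` is the Artin symbol of the
image idèle (Tate 5.4: `ψ_K = lim ψ_{L/K}`). [cite: MilneCM2006, Ch. II §9, Lemma 9.8 (p. 77)]
[cite: CasselsFrohlichANT1967, Ch. VII 5.4 (PDF p. 213)] -/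
theorem abRestrict_inducedArtinHom_ideleArtinMap (s : ideleGroup k) :
    haveI : NumberField L' := NumberField.of_module_finite K L'
    abRestrict L' (inducedArtinHom f hf hfp (ideleArtinMap k s)) =
      artinIdeleMap L' artinReciprocity_character_holds (f s) := by
  rw [inducedArtinHom_ideleArtinMap]
  exact abRestrict_ideleArtinMap L' (f s)

/-- `η [s, k]|_{L'} = 1 ↔ f s ∈ K^× N_{L'|K} 𝕀_{L'}` (Tate 5.1 (B)). [cite: MilneCM2006, Ch. II §9, Lemma 9.8 (p. 77)]
[cite: CasselsFrohlichANT1967, Ch. VII §5.1 Main Theorem (B) (PDF p. 212)] -/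
theorem abRestrict_inducedArtinHom_ideleArtinMap_eq_one_iff (s : ideleGroup k) :
    haveI : NumberField L' := NumberField.of_module_finite K L'
    abRestrict L' (inducedArtinHom f hf hfp (ideleArtinMap k s)) = 1 ↔ f s ∈ Automorphic.normGroup K L' := by
  rw [inducedArtinHom_ideleArtinMap]
  exact abRestrict_ideleArtinMap_eq_one_iff L' (f s)

end FiniteLevel

section Functorial

variable {k' : Type} [Field k'] [NumberField k']

/-- **Functoriality: the identity of `𝕀_k` induces the identity of `Γ_k^ab`.**
[cite: MilneCM2006, Ch. II §9, Lemma 9.8 (p. 77)] -/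
theorem inducedArtinHom_id :
    inducedArtinHom (MonoidHom.id (ideleGroup k)) continuous_id (fun _ ha => ha) =
      MonoidHom.id (absoluteGaloisGroupAbelianization k) :=
  (eq_inducedArtinHom_of_comp_eq (MonoidHom.id (ideleGroup k)) continuous_id (fun _ ha => ha)
    (by rw [MonoidHom.id_comp, MonoidHom.comp_id])).symm

/-- **Functoriality: `η_{g ∘ f} = η_g ∘ η_f`** for continuous `f : 𝕀_{k'} → 𝕀_k`, `g : 𝕀_k → 𝕀_K` carrying
principal idèles to principal idèles (by uniqueness). [cite: MilneCM2006, Ch. II §9, Lemma 9.8 (p. 77)] -/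
theorem inducedArtinHom_comp (f : ideleGroup k' →* ideleGroup k) (hf : Continuous f)
    (hfp : ∀ a ∈ principalIdeles k', f a ∈ principalIdeles k)
    (g : ideleGroup k →* ideleGroup K) (hg : Continuous g)
    (hgp : ∀ a ∈ principalIdeles k, g a ∈ principalIdeles K) :
    inducedArtinHom (g.comp f) (hg.comp hf) (fun a ha => hgp _ (hfp a ha)) =
      (inducedArtinHom g hg hgp).comp (inducedArtinHom f hf hfp) := by
  symm
  refine eq_inducedArtinHom_of_forall _ _ _ fun s => ?_
  rw [MonoidHom.comp_apply, inducedArtinHom_ideleArtinMap, inducedArtinHom_ideleArtinMap, MonoidHom.comp_apply]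

end Functorial

end Literature.NumberTheory.NumberFields

end
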